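import Literature.NumberTheory.ModularSymbols.FullLevelHomologyHeckeProjectorInt
import Literature.NumberTheory.EllipticCurves.ModularJacobianMultiplicityOneCosocleProofs
import Literature.LinearAlgebra.IsotypicQuasiProjector
import Mathlib.RingTheory.Localization.Integer
import Mathlib.RingTheory.Flat.Basic
import HarnessLib

/-!
# The integral Hecke quasi-projector `c·e_f ∈ ℤ[T_q : q ≠ p]` from rational multiplicity one

Topic `Literature/NumberTheory/ModularSymbols`; namespace `Literature.NumberTheory.ModularSymbols`; sequel of
`FullLevelHomologyHeckeProjectorInt` (`heckeIntGenSet`, the hypothesis shape of the K-line) and of the linear algebra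
`Literature.LinearAlgebra.IsotypicQuasiProjector` (Fitting quasi-projectors in `F[T_i]`).  Proved theorems only (no named fact, no
`sorry`, no instance, no notation).

Let `f ∈ S₂(Γ₀(N))`, a finite family of primes `q_i ≠ p` with `T_{q_i} f = a_i f` (`a_i ∈ ℤ`), and suppose RATIONAL MULTIPLICITY
ONE in the generalised form: the joint generalised `a`-eigenspace of the `T_{q_i}` on `H(N; ℚ) = ℚ ⊗ H₁(X₀(N), ℤ)` meets
`ker(periodClassK f)` trivially (for a newform `f` and `q_i ∤ N` separating `f` from the other eigen-systems this is Eichler–Shimura +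
strong multiplicity one).  THEN (`exists_intHeckeQuasiProjector`) there are `θ₀ ∈ ℤ[T_q : q ≠ p] ⊂ 𝕋 = HeckeRing0 N 2` and
`c ∈ ℤ ∖ {0}` with `θ₀ · ker(per_f) = 0` and `per_f(θ₀ x) = c · per_f(x)` on `Λ_N = H₁(X₀(N), ℤ)` — exactly the hypothesis `hprojZ` of
`Summit.…TeichmullerTwistDescent.KOfIntHeckeProjector.twistedPeriodLatticeSaturation_of_intHeckeProjector`.

Steps: the quasi-projector `e ∈ ℚ[T_{q_i}]` on `H(N; ℚ)` (linear algebra); clearing denominators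
(`exists_int_smul_mem_adjoin_int`, `IsLocalization.exist_integer_multiples_of_finset`) to `θ₀ ∈ ℤ[T_q]` with `hecke θ₀ = c·e`;
descent of the two identities from `ℚ ⊗ Λ` to `Λ` (`one_tmul_injective`: `Λ`, `Λ_f` are torsion-free, hence flat over `ℤ`).

## References
* G. Shimura, *Introduction to the arithmetic theory of automorphic functions* (1971), Thm. 3.41, Thm. 3.51. [Shimura1971]
* J. E. Cremona, *Algorithms for Modular Elliptic Curves* (1997), §2.4, §2.10. [CremonaAlgorithms1997]
* N. Jacobson, *Basic Algebra II* (1989), §3.4 (38). [Jacobson1989BasicAlgebraII]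
-/

noncomputable section

namespace Literature.NumberTheory.ModularSymbols

open scoped MatrixGroups TensorProduct
open CongruenceSubgroup
open Literature.NumberTheory.EllipticCurves.ModularForms

/-! ### Clearing denominators in `ℚ[S] ⊂ B` -/

/-- **Clearing denominators**: an element of the `ℚ`-subalgebra generated by `G` has a nonzero integer multiple in the
`ℤ`-subalgebra generated by `G`. [cite: Jacobson1989BasicAlgebraII, §3.4] -/
theorem exists_int_smul_mem_adjoin_int {B : Type*} [Ring B] [Algebra ℚ B] (G : Set B) {e : B} (he : e ∈ Algebra.adjoin ℚ G) :
    ∃ d : ℤ, d ≠ 0 ∧ (d : ℚ) • e ∈ Algebra.adjoin ℤ G := by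
  classical
  have he' : e ∈ Submodule.span ℚ (Submonoid.closure G : Set B) := by
    rw [← Algebra.adjoin_eq_span]; exact he
  obtain ⟨c, hc, rfl⟩ := Submodule.mem_span_set.mp he'
  obtain ⟨b, hb⟩ := IsLocalization.exist_integer_multiples_of_finset (nonZeroDivisors ℤ) (c.support.image c)
  refine ⟨(b : ℤ), nonZeroDivisors.coe_ne_zero b, ?_⟩
  rw [Finsupp.sum, Finset.smul_sum]
  refine Subalgebra.sum_mem _ fun m hm => ?_
  obtain ⟨z, hz⟩ := hb (c m) (Finset.mem_image_of_mem c hm)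
  have hzq : (z : ℚ) = (b : ℤ) * c m := by
    rw [show (z : ℚ) = algebraMap ℤ ℚ z from rfl, hz, zsmul_eq_mul]
  rw [smul_smul, ← hzq, Int.cast_smul_eq_zsmul]
  refine Subalgebra.zsmul_mem _ ?_ z
  have hm' : m ∈ (Submonoid.closure G : Set B) := hc hm
  rw [SetLike.mem_coe] at hm'
  exact Submonoid.closure_le.mpr (Algebra.subset_adjoin (R := ℤ) (s := G)) hm'

/-! ### `Λ ↪ ℚ ⊗ Λ` for flat (e.g. torsion-free) `ℤ`-modules -/

/-- `x ↦ 1 ⊗ x : M → ℚ ⊗_ℤ M` is injective for a flat `ℤ`-module `M`. [cite: CremonaAlgorithms1997, §2.10] -/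
theorem one_tmul_injective (M : Type*) [AddCommGroup M] [Module ℤ M] [Module.Flat ℤ M] :
    Function.Injective (fun x : M => (1 : ℚ) ⊗ₜ[ℤ] x) := by
  have hinj : Function.Injective (Algebra.linearMap ℤ ℚ) := fun x y h => by
    simpa [Algebra.linearMap_apply] using h
  have h := Module.Flat.rTensor_preserves_injective_linearMap (M := M) (Algebra.linearMap ℤ ℚ) hinj
  intro x y hxy
  have hx : (Algebra.linearMap ℤ ℚ).rTensor M ((1 : ℤ) ⊗ₜ[ℤ] x) = (1 : ℚ) ⊗ₜ[ℤ] x := by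
    rw [LinearMap.rTensor_tmul, Algebra.linearMap_apply, map_one]
  have hy : (Algebra.linearMap ℤ ℚ).rTensor M ((1 : ℤ) ⊗ₜ[ℤ] y) = (1 : ℚ) ⊗ₜ[ℤ] y := by
    rw [LinearMap.rTensor_tmul, Algebra.linearMap_apply, map_one]
  have h1 : (1 : ℤ) ⊗ₜ[ℤ] x = (1 : ℤ) ⊗ₜ[ℤ] y := h (by rw [hx, hy]; exact hxy)
  have h2 := congrArg (TensorProduct.lid ℤ M) h1
  simpa using h2

/-! ### The integral quasi-projector -/

variable (N : ℕ) [NeZero N] (p : ℕ)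

/-- **The integral Hecke quasi-projector from rational (generalised) multiplicity one.**  For `f ∈ S₂(Γ₀(N))`, primes `q_i ≠ p`
(`i ∈ s`) with `T_{q_i} f = a_i f`, `a_i ∈ ℤ`, such that the joint generalised `a`-eigenspace of the `T_{q_i}` on `H(N; ℚ)` meets
`ker(periodClassK f)` trivially, there are `θ₀ ∈ ℤ[T_q : q ≠ p] ⊂ 𝕋` and `c ≠ 0` with `θ₀ · ker(per_f) = 0` and
`per_f ∘ θ₀ = c · per_f` on `H₁(X₀(N), ℤ)`. [cite: Shimura1971, Thm. 3.41 and Thm. 3.51; CremonaAlgorithms1997, §2.10] -/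
theorem exists_intHeckeQuasiProjector (f : CuspForm (Gamma0 N) 2) {ι : Type*} (s : Finset ι) (q : ι → ℕ)
    (hq : ∀ i, (q i).Prime) (hqp : ∀ i, q i ≠ p) (a : ι → ℤ)
    (hT : ∀ i ∈ s, HeckeRing0.toEnd N 2 (HeckeRing0.T N 2 (q i) (hq i)) f = (a i : ℂ) • f)
    (hMO : ∀ v : CuspidalHomologyHeckeModule N ℚ,
      (∀ i ∈ s, v ∈ Module.End.maxGenEigenspace (heckeOp N ℚ (q i) (hq i)) (a i : ℚ)) → periodClassK N ℚ f v = 0 → v = 0) :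
    ∃ (θ₀ : HeckeRing0 N 2) (c : ℤ), θ₀ ∈ Algebra.adjoin ℤ (FullLevel.heckeIntGenSet N p) ∧ c ≠ 0 ∧
      (∀ x : periodHomologyHecke N, periodMapLattice N f x = 0 → θ₀ • x = 0) ∧
      ∀ x : periodHomologyHecke N, periodMapLattice N f (θ₀ • x) = c • periodMapLattice N f x := by
  haveI := moduleFinite_int_periodHomologyHecke N
  haveI := moduleFree_int_periodHomologyHecke N
  -- the rational quasi-projector
  set T : ι → Module.End ℚ (CuspidalHomologyHeckeModule N ℚ) := fun i => heckeOp N ℚ (q i) (hq i) with hTdef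
  have hcomm : ∀ i j, Commute (T i) (T j) := fun i j => by
    rw [Commute, SemiconjBy, Module.End.mul_eq_comp, Module.End.mul_eq_comp]
    exact heckeOp_comm N ℚ (q i) (q j) (hq i) (hq j)
  have hφ : ∀ i ∈ s, ∀ v, periodClassK N ℚ f (T i v) = (fun i => (a i : ℚ)) i • periodClassK N ℚ f v :=
    fun i hi v => periodClassK_heckeOp_of_eigen N ℚ (hq i) (hT i hi) v
  obtain ⟨e, he, hφe, hkill⟩ := Literature.LinearAlgebra.CommutingFamily.exists_quasiProjector_of_inf_eq_bot s T hcomm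
    (fun i => (a i : ℚ)) (periodClassK N ℚ f) hφ hMO
  -- `e ∈ ℚ[ψ(G)]` for `ψ = hecke N ℚ`, `G` the generators `T_q`, `q ≠ p`
  set ψ : HeckeRing0 N 2 →ₐ[ℤ] Module.End ℚ (CuspidalHomologyHeckeModule N ℚ) := (hecke N ℚ).toIntAlgHom with hψ
  have hrange : Set.range T ⊆ ψ '' FullLevel.heckeIntGenSet N p := by
    rintro _ ⟨i, rfl⟩
    exact ⟨HeckeRing0.T N 2 (q i) (hq i), ⟨q i, hq i, hqp i, rfl⟩, rfl⟩
  have he' : e ∈ Algebra.adjoin ℚ (ψ '' FullLevel.heckeIntGenSet N p) := Algebra.adjoin_mono hrange he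
  -- clear denominators and pull back to `𝕋`
  obtain ⟨d, hd, hde⟩ := exists_int_smul_mem_adjoin_int _ he'
  rw [← AlgHom.map_adjoin] at hde
  obtain ⟨θ₀, hθ₀, hψθ⟩ := Subalgebra.mem_map.mp hde
  refine ⟨θ₀, d, hθ₀, hd, fun x hx => ?_, fun x => ?_⟩
  · -- killing `ker per_f`
    have h1 : ψ θ₀ ((1 : ℚ) ⊗ₜ[ℤ] x) = (1 : ℚ) ⊗ₜ[ℤ] (θ₀ • x) := hecke_tmul N ℚ θ₀ 1 x
    have h2 : ψ θ₀ ((1 : ℚ) ⊗ₜ[ℤ] x) = 0 := by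
      rw [hψθ, LinearMap.smul_apply, hkill _ (by rw [periodClassK_tmul, hx, TensorProduct.tmul_zero]), smul_zero]
    exact one_tmul_injective (periodHomologyHecke N) (by simpa using (h1.symm.trans h2))
  · -- scaling
    have h1 : periodClassK N ℚ f (ψ θ₀ ((1 : ℚ) ⊗ₜ[ℤ] x)) = (1 : ℚ) ⊗ₜ[ℤ] periodMapLattice N f (θ₀ • x) := by
      rw [show ψ θ₀ ((1 : ℚ) ⊗ₜ[ℤ] x) = (1 : ℚ) ⊗ₜ[ℤ] (θ₀ • x) from hecke_tmul N ℚ θ₀ 1 x, periodClassK_tmul]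
    have h2 : periodClassK N ℚ f (ψ θ₀ ((1 : ℚ) ⊗ₜ[ℤ] x)) = (1 : ℚ) ⊗ₜ[ℤ] (d • periodMapLattice N f x) := by
      rw [hψθ, LinearMap.smul_apply, map_smul, hφe, periodClassK_tmul, TensorProduct.tmul_smul, Int.cast_smul_eq_zsmul]
    exact one_tmul_injective ((periodLattice f).toIntSubmodule) (h1.symm.trans h2)

end Literature.NumberTheory.ModularSymbols
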